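import Summits.BirchSwinnertonDyer.BirchSwinnertonDyer.Theorems.SignedLowerHalvesSprungLowerDivisibilityAtThreeCyclotomicLowerAtXiRankGrowth
import Summits.BirchSwinnertonDyer.BirchSwinnertonDyer.Theorems.SignedLowerHalvesSprungLowerDivisibilityAtThreeCyclotomicLowerAtT
import Summits.BirchSwinnertonDyer.Rank1Residual.Iwasawa.RankGrowthLayer
import HarnessLib

/-!
# Crux K1 `SprungLowerDivisibilityAtThree` (stmt-BirchSwinnertonDyer-19875), line `chromatic-common-zeros`,
# stub S4b at the FIRST cyclotomic prime — THE DOOR: the Eisenstein inequality `ℓ_𝔭 Λ/(G^•) ≤ ℓ_𝔭 X^•` at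
# `𝔭 = (ξ_p)`, `ξ_p = Φ_p(1+T)`, for BOTH colours, from a first-layer rank-growth certificate
# (`--supports` 19875 as helper; closes nothing by itself)

The registered stub S4b (`ChromaticCommonZeros.stub_cyclotomicLowerRest`, skeleton v6 of the lead) asks, in
K1's binder telescope for colour `•`, at a height-one prime `𝔭 ∋ ω_n` with `¬(T ∈ 𝔭 ∧ r_an ≤ 1)` that is a
common zero of both normalised chromatic `p`-adic `L`-functions, for `ℓ_𝔭 Λ/(G^•) ≤ ℓ_𝔭 X^•(E/ℚ_∞)`. This
file settles the case `n = 1`, `T ∉ 𝔭` — i.e. `𝔭 = (ξ_p)` (§1 `asIdeal_eq_span_xi_of_omega_one_mem`: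
`ω_1 = T·ξ_p`, `(ξ_p)` is a height-one prime, tree `isPrime_span_xi` / `height_span_xi`) — PER PAIR, from
the certificate «`ℓ_𝔭 Λ/(G♯) ≤ t` (the multiplicity of the zero `ζ_p − 1` of the sharp `p`-adic
`L`-function, a finite `p`-adic computation) and `rank E(ℚ) + (p − 1)·t ≤ rank E(ℚ_1)` (exact points over
the first layer; `ℚ_1 = ℚ(ζ_9)⁺` at `p = 3`)»:

* §2 `sharp_lengthAt_quotient_le_of_rank_le` — colour `♯`: the sibling theorem
  `rat_natCast_le_lengthAt_sharp_of_rank_le` (`t ≤ ℓ_𝔭 X♯`, Greenberg's p. 132 argument for Sprung's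
  `Sel♯` + `Ker Col♯` kills `E(ℚ_{p,1})`) composed with the certificate;
* §3 `lengthAt_quotient_le_at_xi_of_rank_le` — EITHER colour `•`: the lead's colour transfer
  `lengthAt_quotient_le_of_otherColour` (two chromatic Coleman–Kato packages on ONE `𝐇¹` with a common
  zeta line, Sprung 2012 Thm. 7.14 (3) / Prop. 7.19; `E[p]` irreducible) moves the `♯` inequality to `•`.

USE (x8 census, R5 table): the cells with an exact common zero of `(L♯, L♭)` at `Φ_3(1+T)` (cubic
conductor-`9` twists with `L(E, χ, 1) = 0`) close for K1 at that prime with `t = 1`, i.e. TWO new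
independent points of `E` over `ℚ(ζ_9)⁺` — the `rank_growth` certificate shape of the X1 cell
(`Rank1Residual/Iwasawa/RankGrowthLayer.lean`, `LayerRankGEAt W 3 1 (rank E(ℚ) + 2)`; §4 gives that form).

HONEST FRAMING: helper theorems `--supports` the crux; the rank-growth input is a per-pair CERTIFICATE
(hypothesis), not a theorem — its converse direction `L(E,χ,1) = 0 ⇒` rank growth is open in print for
cubic `χ`; no named fact; K1, Sprung's Main Conjecture 7.21 and BSD on leaf X8 are NOT proved by this file;
S4b stays OPEN class-wide, at the primes `Φ_{p^j}(1+T)`, `j ≥ 2` (no colour reads the layer `j ≥ 2` when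
`a_p ≠ 0`: `u_2 = a_p`, `v_2 = −Φ_p(1+T)`), and at `(T)` in analytic rank `≥ 2`.

References: F. Sprung, J. Number Theory 132 (2012), Thm. 7.14 (3), Prop. 7.19, Main Conj. 7.21 (pp. 1504–1505)
[Sprung2012]; R. Greenberg, LNM 1716 (1999), §5 p. 132 [GreenbergLNM1716]; K. Kato, Astérisque 295 (2004),
§17.13 [Kato2004Asterisque]; L. C. Washington, *Introduction to Cyclotomic Fields*, §13.2 [Washington1997].
-/

set_option autoImplicit false
-- justification: the mandated namespace `Summit.BirchSwinnertonDyer.BirchSwinnertonDyer.Theorems`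
-- (single-conjunct summit, Sub = Summit) repeats a segment by design (D-0017).
set_option linter.dupNamespace false

noncomputable section

open Literature.NumberTheory.EllipticCurves Literature.NumberTheory.GaloisRepresentations
  Literature.NumberTheory.EllipticCurves.IwasawaAlgebra
  Literature.NumberTheory.EllipticCurves.Sprung2017 Literature.NumberTheory.EllipticCurves.Sprung2012
  Literature.NumberTheory.EllipticCurves.Kobayashi2003
  WeierstrassCurve ZpExtension NumberField IsDedekindDomain
  Summit.BirchSwinnertonDyer.Rank1Residual.Iwasawa Summit.BirchSwinnertonDyer.Rank1Residual.X1.CyclotomicZeros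

open scoped Classical NumberField

namespace Summit.BirchSwinnertonDyer.BirchSwinnertonDyer.Theorems.ChromaticCommonZeros

/-! ## §1 The first cyclotomic prime off `(T)` is `(ξ_p)` -/

section Prime

variable {p : ℕ} [Fact p.Prime]

/-- `ω_1 = T · ξ_p` in `Λ` (`ξ_p · T = (1+T)^p − 1`, tree `xi_mul_X`). [folklore] -/
theorem map_cyclotomicOmega_one_eq_X_mul_xi :
    ((cyclotomicOmega p 1).map (Int.castRingHom ℤ_[p]) : PowerSeries ℤ_[p]) =
      (PowerSeries.X : IwasawaAlgebra p) * xi p := by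
  rw [mul_comm, xi_mul_X, cyclotomicOmega]
  simp [Polynomial.map_sub, Polynomial.map_pow, Polynomial.map_add, Polynomial.coe_sub, Polynomial.coe_pow,
    Polynomial.coe_add, Polynomial.coe_one, Polynomial.coe_X, add_comm]

/-- **A height-one prime `𝔭 ∋ ω_1` with `T ∉ 𝔭` is `(ξ_p)`**: `ω_1 = T·ξ_p` and `𝔭` prime give `ξ_p ∈ 𝔭`,
so `(ξ_p) ≤ 𝔭`; `(ξ_p)` is a prime of height one (`isPrime_span_xi`, `height_span_xi`) and primes of equal
finite height are equal when nested. (The `n = 1` case of the S4b binder `∃ n, ω_n ∈ 𝔭`, off `(T)`.)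
[cite: Washington1997, §13.2 (height-one primes of Λ)] -/
theorem asIdeal_eq_span_xi_of_omega_one_mem (𝔭 : PrimeSpectrum (IwasawaAlgebra p))
    (h𝔭 : 𝔭.asIdeal.height = 1)
    (hω : ((cyclotomicOmega p 1).map (Int.castRingHom ℤ_[p]) : PowerSeries ℤ_[p]) ∈ 𝔭.asIdeal)
    (hT : (PowerSeries.X : IwasawaAlgebra p) ∉ 𝔭.asIdeal) : 𝔭.asIdeal = Ideal.span {xi p} := by
  rw [map_cyclotomicOmega_one_eq_X_mul_xi] at hω
  have hxi : xi p ∈ 𝔭.asIdeal := (𝔭.isPrime.mem_or_mem hω).resolve_left hT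
  have hle : Ideal.span {xi p} ≤ 𝔭.asIdeal := (Ideal.span_singleton_le_iff_mem _).mpr hxi
  haveI := isPrime_span_xi p
  symm
  by_contra hne
  have hlt : Ideal.span {xi p} < 𝔭.asIdeal := lt_of_le_of_ne hle hne
  have h1 : (Ideal.span {xi p}).height + 1 ≤ 𝔭.asIdeal.height :=
    Ideal.height_add_one_le_of_lt_of_isPrime hlt
  rw [height_span_xi, h𝔭] at h1
  exact lt_irrefl (1 : ℕ∞) ((ENat.add_one_le_iff ENat.one_ne_top).mp h1)

end Prime

/-! ## §2–§3 The door at `(ξ_p)`: colour `♯`, then either colour -/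

section S4b

variable (W : WeierstrassCurve ℚ) [W.IsElliptic] (p : ℕ) [Fact p.Prime]

/-- **S4b at `(ξ_p)` for the SHARP colour, from the certificate.** In K1's binder telescope for colour `♯`
(datum `D` of `Sel♯(E/ℚ_∞)` with `X♯` finitely generated, normalised `G♯` — or ANY `G`), at a prime
`𝔭 = (ξ_p)`: if `ℓ_𝔭 Λ/(G) ≤ t` (the multiplicity of the zero `ζ_p − 1` of `G♯`, a 3-adic numerical datum
per pair) and `rank E(ℚ) + (p − 1)·t ≤ rank E(ℚ_1)` (exact points over the first layer), then
`ℓ_𝔭 Λ/(G) ≤ ℓ_𝔭 X♯` — the inequality demanded by `stub_cyclotomicLowerRest` at this `𝔭`.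
[cite: Sprung2012, Prop. 7.19 and Main Conj. 7.21 (p. 1505)] [cite: GreenbergLNM1716, §5 p. 132] -/
theorem sharp_lengthAt_quotient_le_of_rank_le (hp2 : p ≠ 2) {ap : ℤ} (hap : (p : ℤ) ∣ ap)
    {κ : ZpExtension ℚ p} {γ : Field.absoluteGaloisGroup ℚ} (hγ : κ.IsTopGenerator γ)
    {v : HeightOneSpectrum (𝓞 ℚ)} {g : Field.absoluteGaloisGroup (v.adicCompletion ℚ)}
    (hg : κ.IsTopGenerator (resGalOfEmb (closureEmb (K := ℚ) (v.adicCompletion ℚ)) g))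
    {cneg : localPoints W (v.adicCompletion ℚ)} {c : ℕ → localPoints W (v.adicCompletion ℚ)}
    (hH : IsHondaSystem κ (closureEmb (K := ℚ) (v.adicCompletion ℚ)) W ap g cneg c)
    (D : SharpFlatSelmerDualData W κ γ (closureEmb (K := ℚ) (v.adicCompletion ℚ)) ap g c Chroma.sharp)
    [Module.Finite (IwasawaAlgebra p) D.X] (G : IwasawaAlgebra p)
    (𝔭 : PrimeSpectrum (IwasawaAlgebra p)) (h𝔭 : 𝔭.asIdeal = Ideal.span {xi p}) {t : ℕ}
    (hG : Module.lengthAt (IwasawaAlgebra p) (IwasawaAlgebra p ⧸ Ideal.span {G}) 𝔭 ≤ t)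
    (ht : W.mordellWeilRank + (p - 1) * t ≤ (W.baseChange (κ.layer 1)).mordellWeilRank) :
    Module.lengthAt (IwasawaAlgebra p) (IwasawaAlgebra p ⧸ Ideal.span {G}) 𝔭 ≤
      Module.lengthAt (IwasawaAlgebra p) D.X 𝔭 :=
  hG.trans (rat_natCast_le_lengthAt_sharp_of_rank_le W p hp2 hap hγ hg hH D 𝔭 h𝔭 ht)

/-- **S4b at `(ξ_p)` for EITHER colour, from the certificate** (the lead's colour transfer
`lengthAt_quotient_le_of_otherColour` on ONE `𝐇¹` with a common zeta line, Sprung 2012 Thm. 7.14 (3) /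
Prop. 7.19). In K1's binder telescope for colour `•` (`E[p]` irreducible; Sprung pair `(L♯, L♭)` with
`L^• ≠ 0`, `L♯ ≠ 0`; normalised `G^•`, `G♯` with `G♯ ≠ 0`; joint packages `C` (colour `•`), `C♯` with
`C.Z = C♯.Z`; dual data `D` of `Sel^•`, `D♯` of `Sel♯`, `X♯` finitely generated; Honda system), at the
height-one prime `𝔭 = (ξ_p)` (e.g. a height-one `𝔭 ∋ ω_1` with `T ∉ 𝔭`, §1): `ℓ_𝔭 Λ/(G♯) ≤ t` and
`rank E(ℚ) + (p−1)·t ≤ rank E(ℚ_1)` give `ℓ_𝔭 Λ/(G^•) ≤ ℓ_𝔭 X^•`. For `p = 3` (`ξ_3 = T² + 3T + 3`, `ℚ_1 = ℚ(ζ_9)⁺` when `κ` is cyclotomic) this is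
the registered S4b inequality at its first prime, per pair, from a rank-growth certificate.
[cite: Sprung2012, Thm. 7.14 (3) (p. 1504), Prop. 7.19 and Main Conj. 7.21 (p. 1505)]
[cite: GreenbergLNM1716, §5 p. 132] [cite: Kato2004Asterisque, §17.13 (p. 280)] -/
theorem lengthAt_quotient_le_at_xi_of_rank_le
    [ContinuousSMul ℤ_[p] (W.tateModule p)] [Module.Free ℤ_[p] (W.tateModule p)]
    [Module.Finite ℤ_[p] (W.tateModule p)]
    (hp2 : p ≠ 2) {ap : ℤ} (hap : (p : ℤ) ∣ ap)
    {N : ℕ} {f : CuspForm (CongruenceSubgroup.Gamma0 N) 2} {ϖ : ℚ}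
    {κ : ZpExtension ℚ p} {γ : Field.absoluteGaloisGroup ℚ} (hγ : κ.IsTopGenerator γ)
    {v : HeightOneSpectrum (𝓞 ℚ)} {g : Field.absoluteGaloisGroup (v.adicCompletion ℚ)}
    (hg : κ.IsTopGenerator (resGalOfEmb (closureEmb (K := ℚ) (v.adicCompletion ℚ)) g))
    {cneg : localPoints W (v.adicCompletion ℚ)} {c : ℕ → localPoints W (v.adicCompletion ℚ)}
    (hH : IsHondaSystem κ (closureEmb (K := ℚ) (v.adicCompletion ℚ)) W ap g cneg c)
    {col : Chroma} {I : Kato2004.IwasawaH1Data W p κ γ}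
    (C : SharpFlatColemanKatoData W p f ϖ κ γ (closureEmb (K := ℚ) (v.adicCompletion ℚ)) ap g c col I)
    (Cs : SharpFlatColemanKatoData W p f ϖ κ γ (closureEmb (K := ℚ) (v.adicCompletion ℚ)) ap g c
      Chroma.sharp I)
    (hZ : C.Z = Cs.Z) (hirr : W.HasIrreducibleModPGaloisRep p) {Lsharp Lflat G Gs : IwasawaAlgebra p}
    (hSP : IsSprungPair f p ap Lsharp Lflat) (hcol : chromaticL col Lsharp Lflat ≠ 0) (hLs : Lsharp ≠ 0)
    (hG : iwasawaToPowerSeries p G =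
      PowerSeries.C ((ϖ : ℚ) : ℚ_[p]) * iwasawaToPowerSeries p (chromaticL col Lsharp Lflat))
    (hGs : iwasawaToPowerSeries p Gs = PowerSeries.C ((ϖ : ℚ) : ℚ_[p]) * iwasawaToPowerSeries p Lsharp)
    (hGs0 : Gs ≠ 0)
    (D : SharpFlatSelmerDualData W κ γ (closureEmb (K := ℚ) (v.adicCompletion ℚ)) ap g c col)
    (Ds : SharpFlatSelmerDualData W κ γ (closureEmb (K := ℚ) (v.adicCompletion ℚ)) ap g c Chroma.sharp)
    [Module.Finite (IwasawaAlgebra p) Ds.X]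
    (𝔭 : PrimeSpectrum (IwasawaAlgebra p)) (h𝔭 : 𝔭.asIdeal.height = 1)
    (hxi : 𝔭.asIdeal = Ideal.span {xi p}) {t : ℕ}
    (hGt : Module.lengthAt (IwasawaAlgebra p) (IwasawaAlgebra p ⧸ Ideal.span {Gs}) 𝔭 ≤ t)
    (ht : W.mordellWeilRank + (p - 1) * t ≤ (W.baseChange (κ.layer 1)).mordellWeilRank) :
    Module.lengthAt (IwasawaAlgebra p) (IwasawaAlgebra p ⧸ Ideal.span {G}) 𝔭 ≤
      Module.lengthAt (IwasawaAlgebra p) D.X 𝔭 := by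
  have hs : Module.lengthAt (IwasawaAlgebra p) (IwasawaAlgebra p ⧸ Ideal.span {Gs}) 𝔭 ≤
      Module.lengthAt (IwasawaAlgebra p) Ds.X 𝔭 :=
    sharp_lengthAt_quotient_le_of_rank_le W p hp2 hap hγ hg hH Ds Gs 𝔭 hxi hGt ht
  have hGs' : iwasawaToPowerSeries p Gs =
      PowerSeries.C ((ϖ : ℚ) : ℚ_[p]) * iwasawaToPowerSeries p (chromaticL Chroma.sharp Lsharp Lflat) := by
    rw [chromaticL_sharp]; exact hGs
  have hcols : chromaticL Chroma.sharp Lsharp Lflat ≠ 0 := by rw [chromaticL_sharp]; exact hLs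
  exact lengthAt_quotient_le_of_otherColour W p hγ C Cs hZ hirr hSP hcol hcols hG hGs' hGs0 D Ds 𝔭 h𝔭 hs

end S4b


/-! ## §4 The same with the census certificate shape `LayerRankGEAt` (cyclotomic `κ`) -/

section Cert

variable (W : WeierstrassCurve ℚ) [W.IsElliptic] (p : ℕ) [Fact p.Prime]

/-- **Colour `♯` at `(ξ_p)` from the typed census certificate** `LayerRankGEAt W p 1 (rank E(ℚ) + (p−1)·t)`
(`Rank1Residual/Iwasawa/RankGrowthLayer.lean`: "`m ≤ rank E(ℚ_1)` for THE cyclotomic `ℤ_p`-extension", the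
shape discharged in exact arithmetic by the X1 cell's `rank_growth` engine) and `ℓ_𝔭 Λ/(G) ≤ t`:
`ℓ_𝔭 Λ/(G) ≤ ℓ_𝔭 X♯` for the cyclotomic `κ` of the crux telescope. [cite: GreenbergLNM1716, §5 p. 132]
[cite: Sprung2012, Prop. 7.19 and Main Conj. 7.21 (p. 1505)] -/
theorem sharp_lengthAt_quotient_le_of_layerRankGEAt (hp2 : p ≠ 2) {ap : ℤ} (hap : (p : ℤ) ∣ ap)
    {κ : ZpExtension ℚ p} (hκ : κ.IsCyclotomic) {γ : Field.absoluteGaloisGroup ℚ} (hγ : κ.IsTopGenerator γ)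
    {v : HeightOneSpectrum (𝓞 ℚ)} {g : Field.absoluteGaloisGroup (v.adicCompletion ℚ)}
    (hg : κ.IsTopGenerator (resGalOfEmb (closureEmb (K := ℚ) (v.adicCompletion ℚ)) g))
    {cneg : localPoints W (v.adicCompletion ℚ)} {c : ℕ → localPoints W (v.adicCompletion ℚ)}
    (hH : IsHondaSystem κ (closureEmb (K := ℚ) (v.adicCompletion ℚ)) W ap g cneg c)
    (D : SharpFlatSelmerDualData W κ γ (closureEmb (K := ℚ) (v.adicCompletion ℚ)) ap g c Chroma.sharp)
    [Module.Finite (IwasawaAlgebra p) D.X] (G : IwasawaAlgebra p)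
    (𝔭 : PrimeSpectrum (IwasawaAlgebra p)) (h𝔭 : 𝔭.asIdeal = Ideal.span {xi p}) {t : ℕ}
    (hG : Module.lengthAt (IwasawaAlgebra p) (IwasawaAlgebra p ⧸ Ideal.span {G}) 𝔭 ≤ t)
    (hL : LayerRankGEAt W p 1 (W.mordellWeilRank + (p - 1) * t)) :
    Module.lengthAt (IwasawaAlgebra p) (IwasawaAlgebra p ⧸ Ideal.span {G}) 𝔭 ≤
      Module.lengthAt (IwasawaAlgebra p) D.X 𝔭 :=
  sharp_lengthAt_quotient_le_of_rank_le W p hp2 hap hγ hg hH D G 𝔭 h𝔭 hG (hL κ hκ)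

/-- **Either colour at `(ξ_p)` from the typed census certificate** `LayerRankGEAt W p 1 (rank E(ℚ) + (p−1)·t)`
and `ℓ_𝔭 Λ/(G♯) ≤ t`, in K1's binder telescope (cyclotomic `κ`; joint packages `C`, `C♯` with `C.Z = C♯.Z`;
`E[p]` irreducible): `ℓ_𝔭 Λ/(G^•) ≤ ℓ_𝔭 X^•` at the height-one `𝔭 = (ξ_p)`. At `p = 3` the
certificate reads `LayerRankGEAt W 3 1 (rank E(ℚ) + 2t)`: `2t` new independent points over `ℚ(ζ_9)⁺`.
[cite: Sprung2012, Thm. 7.14 (3) (p. 1504), Prop. 7.19 and Main Conj. 7.21 (p. 1505)]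
[cite: GreenbergLNM1716, §5 p. 132] -/
theorem lengthAt_quotient_le_at_xi_of_layerRankGEAt
    [ContinuousSMul ℤ_[p] (W.tateModule p)] [Module.Free ℤ_[p] (W.tateModule p)]
    [Module.Finite ℤ_[p] (W.tateModule p)]
    (hp2 : p ≠ 2) {ap : ℤ} (hap : (p : ℤ) ∣ ap)
    {N : ℕ} {f : CuspForm (CongruenceSubgroup.Gamma0 N) 2} {ϖ : ℚ}
    {κ : ZpExtension ℚ p} (hκ : κ.IsCyclotomic) {γ : Field.absoluteGaloisGroup ℚ} (hγ : κ.IsTopGenerator γ)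
    {v : HeightOneSpectrum (𝓞 ℚ)} {g : Field.absoluteGaloisGroup (v.adicCompletion ℚ)}
    (hg : κ.IsTopGenerator (resGalOfEmb (closureEmb (K := ℚ) (v.adicCompletion ℚ)) g))
    {cneg : localPoints W (v.adicCompletion ℚ)} {c : ℕ → localPoints W (v.adicCompletion ℚ)}
    (hH : IsHondaSystem κ (closureEmb (K := ℚ) (v.adicCompletion ℚ)) W ap g cneg c)
    {col : Chroma} {I : Kato2004.IwasawaH1Data W p κ γ}
    (C : SharpFlatColemanKatoData W p f ϖ κ γ (closureEmb (K := ℚ) (v.adicCompletion ℚ)) ap g c col I)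
    (Cs : SharpFlatColemanKatoData W p f ϖ κ γ (closureEmb (K := ℚ) (v.adicCompletion ℚ)) ap g c
      Chroma.sharp I)
    (hZ : C.Z = Cs.Z) (hirr : W.HasIrreducibleModPGaloisRep p) {Lsharp Lflat G Gs : IwasawaAlgebra p}
    (hSP : IsSprungPair f p ap Lsharp Lflat) (hcol : chromaticL col Lsharp Lflat ≠ 0) (hLs : Lsharp ≠ 0)
    (hG : iwasawaToPowerSeries p G =
      PowerSeries.C ((ϖ : ℚ) : ℚ_[p]) * iwasawaToPowerSeries p (chromaticL col Lsharp Lflat))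
    (hGs : iwasawaToPowerSeries p Gs = PowerSeries.C ((ϖ : ℚ) : ℚ_[p]) * iwasawaToPowerSeries p Lsharp)
    (hGs0 : Gs ≠ 0)
    (D : SharpFlatSelmerDualData W κ γ (closureEmb (K := ℚ) (v.adicCompletion ℚ)) ap g c col)
    (Ds : SharpFlatSelmerDualData W κ γ (closureEmb (K := ℚ) (v.adicCompletion ℚ)) ap g c Chroma.sharp)
    [Module.Finite (IwasawaAlgebra p) Ds.X]
    (𝔭 : PrimeSpectrum (IwasawaAlgebra p)) (h𝔭 : 𝔭.asIdeal.height = 1)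
    (hxi : 𝔭.asIdeal = Ideal.span {xi p}) {t : ℕ}
    (hGt : Module.lengthAt (IwasawaAlgebra p) (IwasawaAlgebra p ⧸ Ideal.span {Gs}) 𝔭 ≤ t)
    (hL : LayerRankGEAt W p 1 (W.mordellWeilRank + (p - 1) * t)) :
    Module.lengthAt (IwasawaAlgebra p) (IwasawaAlgebra p ⧸ Ideal.span {G}) 𝔭 ≤
      Module.lengthAt (IwasawaAlgebra p) D.X 𝔭 :=
  lengthAt_quotient_le_at_xi_of_rank_le W p hp2 hap hγ hg hH C Cs hZ hirr hSP hcol hLs hG hGs hGs0 D Ds 𝔭 h𝔭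
    hxi hGt (hL κ hκ)

end Cert

end Summit.BirchSwinnertonDyer.BirchSwinnertonDyer.Theorems.ChromaticCommonZeros

end
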